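import Literature.IUT.LogThetaLattice.PacketLogVolumesHaarModelNormalization
import Literature.IUT.LogVolume.TensorPacketCapsuleRegion
import Literature.IUT.LogVolume.ArchimedeanPacketCoordScaling
import Literature.IUT.LogVolume.LocalDegreeBridge
import HarnessLib

/-!
# [IUTchIII] Proposition 3.9 (i)/(iii) for CAPSULES at the genuine model, I: the portions
# `⊗_{α∈A} F_{v_α}` (finite `v_ℚ`) and `⊗_{α∈A} ℂ` (archimedean `v_ℚ`) with their Haar log-volumes and the
# action of `F^×` on ONE label (abc-iut cell, layer L6; residual R-iii-tensor of plan/L6/SUBDAG-IUTchIII-Prop-39.md)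

S. Mochizuki, *Inter-universal Teichmüller theory III*, kurims manuscript (May 2020), §3 [claim: Mochizuki2012,
status: disputed]. Proposition 3.1, p. 92/93: "`log(^A𝓕_{v_ℚ}) := ⊗_{α∈A} log(^α𝓕_{v_ℚ})` … the [n-]tensor packet
… an inductive limit of direct sums of ind-topological fields"; Remark 3.1.1 (ii), p. 94: "when we consider
log-volumes on the portion of `log(^A𝓕_{v_ℚ})` corresponding to the tensor product of various `K_{v_α}`, where
`𝕍 ∋ v_α | v_ℚ`, it will be necessary to consider these log-volumes relative to the weight
`1/∏_{α∈A} [K_{v_α}:(F_mod)_{v_α}]` … the normalized weight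
`1/((∏_{α∈A}[K_{v_α}:(F_mod)_{v_α}])·{Σ_{{w_α}_{α∈A}} ∏_{α∈A}[(F_mod)_{w_α}:ℚ_{v_ℚ}]})`"; Proposition 3.9
(i), p. 115: "the `p_{v_ℚ}`-adic log-volume on each of the direct summand `p_{v_ℚ}`-adic fields of …
`𝓘^ℚ(^A𝓕_{v_ℚ})` … determines … log-volumes `μ^log_{A,v_ℚ} : 𝕄(𝓘^ℚ(^A𝓕_{v_ℚ})) → ℝ`", p. 116 (archimedean
`v_ℚ`): "the sum of the radial log-volumes on each of the direct summand complex archimedean fields … normalized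
so that multiplication … by `e` corresponds to adding `1 = log(e)`"; (iii), p. 117: "a global log-volume
`μ^log_{A,𝕍_ℚ}` … which is invariant with respect to multiplication by elements of `(†𝕄⊛_mod)_α = (†𝕄⊛_MOD)_α
⊆ 𝓘^ℚ(^A𝓕_{𝕍_ℚ})`".

WHAT THIS FILE ADDS. abc-iut-L6-d3's `PacketLogVolumesHaarModel.lean` (p415871) is the genuine adelic Haar
model of Prop. 3.9 (iii) for ONE label (`|A| = 1`, `K = F_mod = F`): summands `F_v`, `ℂ`, Haar / radial
volumes, weights of Remark 3.1.1 (ii), and the invariance under `F^×` from the product formula. Its HONEST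
SCOPE (2) — "the `n`-tensor packet `⊗_α F_{v_α}` … reduces to this file summand-wise, not typed here" — is
the residual R-iii-tensor of the L6 sub-DAG of Prop. 3.9 (abc-iut-w5-d178, handed back 2026-08-26T02:07Z with
all analysis inputs landed). THIS file types, for an arbitrary finite nonempty label set `A` and `K = F_mod = F`,
the PORTIONS of the `A`-packet at one `v_ℚ` and the action of `f ∈ F^×` through ONE label `α`
(`1 ⊗ ⋯ ⊗ f ⊗ ⋯ ⊗ 1`, `f` in the factor `α` — the copy `(†𝕄⊛_mod)_α`):
* `CapsuleDatum F A` — the per-portion package: carrier, admissible regions (positive finite volume),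
  log-volume, the action of `F^×` on each label and its log-modulus, with the ONE law
  `μ^log(f·_α T) = μ^log(T) + shift_α(f)` (a Σ-type of genuine data, not an interface with unproved axioms);
* **`nonarchPortion F A p v⃗`** for `v⃗ : A → 𝕍(F)_p`: the REAL tensor packet `⊗_{α,ℚ_p} F_{v_α}` (campaign-S
  `Literature.IUT.LogVolume.PacketAlgebra` over abc-iut-S7's `RescaledCompletion F p v_α` = Mathlib's
  `v_α.adicCompletion F` normed by `‖·‖_{v}^{1/n_v}`), regions = subsets of positive finite Haar measure,
  `μ^log` = campaign-S `tensorLogVolume` (Haar log-volume divided by `dim_{ℚ_p} = ∏_α n_{v_α}`, normalised by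
  `μ^log((R_I)^∼) = 0`, [IUTchIV] Prop. 1.4 (i)), `f` acting on the label `α` by `ι_α(f)·(−)`; the law is
  abc-iut-S7's `tensorLogVolume_iota_smul` (Dupuy–Hilado (3.7)), and the shift is
  **`(1/n_{v_α})·log‖f‖_{v_α}`** (`nonarchPortion_shift`: `‖f‖_{v}` = Mathlib `adicAbv`, `n_v = e_v f_v`);
* **`archPortion F A w⃗`** for `w⃗ : A → 𝕍(F)^arc`: the REAL archimedean tensor packet `⊗_{α,ℝ} ℂ` (campaign-S
  `Prop15iii.MI A Unit`, [IUTchIV] Prop. 1.5 (iii)) with its canonical decomposition `Φ₀` into `2^{|A|−1}`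
  complex fields, regions = subsets of positive finite volume in the coordinates of `Φ₀`, `μ^log` = campaign-S
  `Prop15iii.packetLogVol Φ₀` (the packet-normalised average of the radial log-volumes of the summands: `B_I ↦ 0`,
  `×e ↦ +1`), `f` acting on the label `α` by `(⊗_β m_β)·(−)`, `m_α = σ_{w_α}(f)`, `m_β = 1` (`β ≠ α`); the law is
  abc-iut-w5-d178's `packetLogVol_image_tprod_mul` (p417264) and the shift is **`log|f|_{w_α}`**
  (`archPortion_shift`).
The weighted sum over the portions, the global log-volume and `Prop39iii_invariance` for every `A` are the
companion `PacketLogVolumesHaarModelCapsules.lean`.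

HONEST SCOPE. `K = F_mod = F` (as in p415871); the archimedean portion is `⊗_ℝ` of copies of `ℂ` at EVERY tuple
of archimedean places (faithful for the totally complex `F ∋ √−1` of [IUTchI] Def. 3.1 (b)); regions are ALL
subsets of positive finite volume (a superset of print's direct-product regions `𝕄(−)`). Nothing here constructs
`(†𝓕⊛_mod)_α`, asserts anything about [IUTchIII] Cor. 3.12, or takes a side; typed ≠ endorsed. The mathematics
is classical (Haar measure on `⊗ K_i`, Lebesgue measure on `ℂ^J`). [cite: DupuyHilado2025, §3.7]
[cite: Mochizuki2012, IUTchIV Prop. 1.4 (i) p. 13]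
-/

noncomputable section

namespace Literature.IUT.LogThetaLattice

open Literature.IUT.LogVolume Literature.NumberTheory.NumberFields NumberField IsDedekindDomain MeasureTheory Set
open scoped ENNReal NNReal Pointwise TensorProduct

/-! ### The per-portion package -/

/-- The datum of [IUTchIII] Prop. 3.9 (i)/(iii) on ONE portion of the `A`-packet at one `v_ℚ`, packaged: the
carrier (a tensor product of `|A|` local fields), the admissible regions (positive finite volume), the
log-volume, the action of `f ∈ F^×` through the label `α ∈ A` ("multiplication by elements of `(†𝕄⊛_mod)_α`")
and its log-modulus `shift α f`, subject to the ONE law `μ^log(f·_α T) = μ^log(T) + shift α f`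
([AbsTopIII] Prop. 5.7 (i)(b)/(ii)(b) through a tensor factor, Dupuy–Hilado (3.7)). A Σ-type packaging of
genuine data (see `nonarchPortion`, `archPortion`). [claim: Mochizuki2012, status: disputed] -/
structure CapsuleDatum (F : Type) [Field F] (A : Type) : Type 1 where
  /-- the portion `⊗_{α∈A} K_{v_α}` -/
  X : Type
  /-- admissible regions: subsets of positive finite volume -/
  IsAdm : Set X → Prop
  /-- the log-volume `μ^log` on subsets -/
  logVol : Set X → ℝ
  /-- multiplication of a subset by `f ∈ F^×` placed in the tensor factor labelled `α` -/
  act : A → Fˣ → Set X → Set X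
  /-- the log-modulus of that multiplication -/
  shift : A → Fˣ → ℝ
  /-- the action preserves admissibility -/
  isAdm_act : ∀ (α : A) (f : Fˣ) (T : Set X), IsAdm T → IsAdm (act α f T)
  /-- `μ^log(f·_α T) = μ^log(T) + shift α f` on admissible `T` -/
  logVol_act : ∀ (α : A) (f : Fˣ) (T : Set X), IsAdm T → logVol (act α f T) = logVol T + shift α f

namespace CapsuleDatum

variable {F : Type} [Field F] {A : Type} (D : CapsuleDatum F A)

/-- The admissible regions of the portion (print's "`𝕄(−)`" ⊆ these). [claim: Mochizuki2012, status: disputed] -/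
def Adm : Type := {T : Set D.X // D.IsAdm T}

/-- `f ∈ F^×` acting through the label `α` on admissible regions. [claim: Mochizuki2012, status: disputed] -/
def actAdm (α : A) (f : Fˣ) (T : D.Adm) : D.Adm := ⟨D.act α f T.1, D.isAdm_act α f T.1 T.2⟩

/-- Underlying set of `f·_α T`. [claim: Mochizuki2012, status: disputed] -/
@[simp] theorem actAdm_val (α : A) (f : Fˣ) (T : D.Adm) : (D.actAdm α f T).1 = D.act α f T.1 := rfl

/-- `μ^log(f·_α T) = μ^log(T) + shift α f`. [claim: Mochizuki2012, status: disputed] -/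
theorem logVol_actAdm (α : A) (f : Fˣ) (T : D.Adm) :
    D.logVol (D.actAdm α f T).1 = D.logVol T.1 + D.shift α f :=
  D.logVol_act α f T.1 T.2

end CapsuleDatum

variable (F : Type) [Field F] [NumberField F]
variable (A : Type) [Fintype A] [DecidableEq A] [Nonempty A]

/-! ### The nonarchimedean portions `⊗_{α,ℚ_p} F_{v_α}` -/

section Nonarch

variable (p : Nat.Primes)

variable {F} in
/-- `p ∈ v` for `v ∈ 𝕍(F)_p`. [cite: NeukirchANT1999, Ch. I §8] -/
theorem natCast_mem_of_mem_placesOver {v : HeightOneSpectrum (𝓞 F)} (hv : v ∈ placesOver F (p : ℕ)) :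
    ((p : ℕ) : 𝓞 F) ∈ v.asIdeal := by
  haveI : Fact (p : ℕ).Prime := ⟨p.2⟩
  have h := (mem_placesOver_iff v).mp hv
  have hmem : ((p : ℕ) : ℤ) ∈ v.asIdeal.under ℤ := by
    rw [← h.over]; exact Ideal.mem_span_singleton_self _
  have := Ideal.mem_comap.mp hmem
  simpa using this

/-- The local field at `v ∈ 𝕍(F)_p`: the completion `F_v` as a normed `ℚ_p`-algebra (abc-iut-S7's
`RescaledCompletion`, norm `‖·‖_v^{1/n_v}`; reducible, so that its normed-field / normed-`ℚ_p`-algebra /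
ultrametric / proper structures are those of `RescaledCompletion` — no instance is declared here).
[cite: NeukirchANT1999, Ch. II Thm. (4.8)] -/
abbrev Kp (v : {v : HeightOneSpectrum (𝓞 F) // v ∈ placesOver F (p : ℕ)}) : Type :=
  RescaledCompletion F p v.1 (natCast_mem_of_mem_placesOver p v.2)

/-- The image of `f ∈ F^×` in `F_v^×` (through Mathlib's `FinitePlace.embedding v : F →+* F_v`).
[claim: Mochizuki2012, status: disputed] -/
def unitAt (v : {v : HeightOneSpectrum (𝓞 F) // v ∈ placesOver F (p : ℕ)}) (f : Fˣ) : (Kp F p v)ˣ :=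
  Units.mk0 (RescaledCompletion.of F p v.1 (natCast_mem_of_mem_placesOver p v.2) (FinitePlace.embedding v.1 (f : F)))
    (by
      intro h
      have h1 : FinitePlace.embedding v.1 (f : F) = 0 :=
        (RescaledCompletion.of F p v.1 (natCast_mem_of_mem_placesOver p v.2)).injective
          (h.trans (map_zero _).symm)
      exact f.ne_zero ((map_eq_zero _).mp h1))

/-- **The rescaled norm of `f` at `v` is `‖f‖_v^{1/n_v}`**: `log‖f‖' = log(‖f‖_v)/n_v` with `‖f‖_v` Mathlib's
`adicAbv` and `n_v = e_v f_v` (`localDegree`). [cite: NeukirchANT1999, Ch. II Thm. (4.8)] -/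
theorem log_norm_unitAt (v : {v : HeightOneSpectrum (𝓞 F) // v ∈ placesOver F (p : ℕ)}) (f : Fˣ) :
    Real.log ‖(unitAt F p v f : Kp F p v)‖ =
      Real.log (NumberField.HeightOneSpectrum.adicAbv F v.1 (f : F)) / localDegree F v.1 := by
  have hn : (localDegree F v.1 : ℝ) ≠ 0 := by exact_mod_cast (localDegree_pos F v.1).ne'
  have key : ‖FinitePlace.embedding v.1 (f : F)‖ =
      ‖(unitAt F p v f : Kp F p v)‖ ^ (localDeg F v.1) :=
    RescaledCompletion.norm_eq_norm_of_pow F p v.1 (natCast_mem_of_mem_placesOver p v.2) _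
  rw [FinitePlace.norm_embedding, localDeg_eq_localDegree] at key
  rw [key, Real.log_pow]
  field_simp

variable [Fact (p : ℕ).Prime] (vA : A → {v : HeightOneSpectrum (𝓞 F) // v ∈ placesOver F (p : ℕ)})

/-- **The nonarchimedean portion `⊗_{α∈A,ℚ_p} F_{v_α}`** of the `A`-packet at `p` for the tuple `v⃗ = (v_α)_α`
of places over `p` ([IUTchIII] Prop. 3.1, Remark 3.1.1 (ii) "the portion of `log(^A𝓕_{v_ℚ})` corresponding to
the tensor product of various `K_{v_α}`"): the REAL tensor packet (campaign-S `PacketAlgebra`) with its Haar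
measure (`integerStructure … .haar`), admissible regions = positive finite measure, `μ^log = tensorLogVolume`
([IUTchIV] Prop. 1.4 (i)), `f ∈ F^×` acting on the label `α` by `ι_α(f)·(−)`, shift `log‖f‖'_{v_α}`
(`tensorLogVolume_iota_smul`, Dupuy–Hilado (3.7)). [claim: Mochizuki2012, status: disputed] -/
def nonarchPortion : CapsuleDatum F A where
  X := PacketAlgebra p (fun α => Kp F p (vA α))
  IsAdm T := 0 < (integerStructure p (fun α => Kp F p (vA α))).haar T ∧
    (integerStructure p (fun α => Kp F p (vA α))).haar T < ∞
  logVol := tensorLogVolume p (fun α => Kp F p (vA α))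
  act α f T := (fun y => iota p (fun α => Kp F p (vA α)) α (unitAt F p (vA α) f : Kp F p (vA α)) * y) '' T
  shift α f := Real.log ‖(unitAt F p (vA α) f : Kp F p (vA α))‖
  isAdm_act α f T hT := by
    have hu : (fun y => iota p (fun α => Kp F p (vA α)) α (unitAt F p (vA α) f : Kp F p (vA α)) * y) '' T =
        (fun y => ((iotaUnits p (fun α => Kp F p (vA α)) α (unitAt F p (vA α) f) :
          (PacketAlgebra p (fun α => Kp F p (vA α)))ˣ) : PacketAlgebra p (fun α => Kp F p (vA α))) * y) '' T := by
      rfl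
    rw [hu]
    exact ⟨haar_image_mulLeft_pos p _ _ hT.1, haar_image_mulLeft_lt_top p _ _ hT.2⟩
  logVol_act α f T hT := tensorLogVolume_iota_smul p (fun α => Kp F p (vA α)) α (unitAt F p (vA α) f) hT.1 hT.2

/-- The shift of the nonarchimedean portion under `f` on the label `α` is **`(1/n_{v_α})·log‖f‖_{v_α}`** — the
change `log‖f‖_{v_α}` of the log-volume of the summand `F_{v_α}` ([AbsTopIII] Prop. 5.7 (i)(b)) divided by the
dimension carried by campaign-S's normalisation. [claim: Mochizuki2012, status: disputed] -/
theorem nonarchPortion_shift (α : A) (f : Fˣ) :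
    (nonarchPortion F A p vA).shift α f =
      Real.log (NumberField.HeightOneSpectrum.adicAbv F (vA α).1 (f : F)) / localDegree F (vA α).1 :=
  log_norm_unitAt F p (vA α) f

/-- The carrier of the nonarchimedean portion is the real tensor packet (definitional).
[claim: Mochizuki2012, status: disputed] -/
theorem nonarchPortion_X : (nonarchPortion F A p vA).X = PacketAlgebra p (fun α => Kp F p (vA α)) := rfl

end Nonarch

/-! ### The archimedean portions `⊗_{α,ℝ} ℂ` -/

section Arch

open Literature.IUT.LogVolume.Prop15iii PiTensorProduct

variable (wA : A → InfinitePlace F)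

/-- The pure tensor by which `f ∈ F^×` on the label `α` multiplies the archimedean portion: `m_α = σ_{w_α}(f)`,
`m_β = 1` for `β ≠ α`. [claim: Mochizuki2012, status: disputed] -/
def archMult (α : A) (f : Fˣ) : A → M Unit := fun β _ => if β = α then (wA α).embedding (f : F) else 1

omit [Fintype A] [Nonempty A] [NumberField F] in
/-- Every entry of the multiplier is a nonzero complex number. [claim: Mochizuki2012, status: disputed] -/
theorem archMult_ne_zero (α : A) (f : Fˣ) (β : A) (u : Unit) : archMult F A wA α f β u ≠ 0 := by
  classical
  unfold archMult
  split_ifs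
  · rw [map_ne_zero]; exact f.ne_zero
  · exact one_ne_zero

omit [Nonempty A] [NumberField F] in
/-- `Σ_β log|m_β| = log|f|_{w_α}` (all other entries are `1`). [claim: Mochizuki2012, status: disputed] -/
theorem sum_log_norm_archMult (α : A) (f : Fˣ) (g : A → Unit) :
    ∑ β, Real.log ‖archMult F A wA α f β (g β)‖ = Real.log ((wA α) (f : F)) := by
  classical
  have h : ∀ β, Real.log ‖archMult F A wA α f β (g β)‖ =
      if β = α then Real.log ((wA α) (f : F)) else 0 := by
    intro β
    unfold archMult
    split_ifs with hβ
    · rw [InfinitePlace.norm_embedding_eq]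
    · rw [norm_one, Real.log_one]
  simp_rw [h]
  rw [Finset.sum_ite_eq' Finset.univ α, if_pos (Finset.mem_univ α)]

/-- **The archimedean portion `⊗_{α∈A,ℝ} ℂ`** of the `A`-packet at `∞` for the tuple `w⃗ = (w_α)_α` of archimedean
places ([IUTchIII] Prop. 3.9 (i) p. 116 "direct summand complex archimedean fields"; [IUTchIV] Prop. 1.5 (iii)):
campaign-S `Prop15iii.MI A Unit` with its canonical decomposition `Φ₀` into `2^{|A|−1}` copies of `ℂ`, admissible
regions = positive finite Lebesgue volume in the coordinates of `Φ₀`, `μ^log = packetLogVol Φ₀` (packet-normalised: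
`B_I ↦ 0`, `×e ↦ +log e`), `f ∈ F^×` acting on the label `α` by the pure tensor `archMult` (`σ_{w_α}(f)` in the
factor `α`), shift `log|f|_{w_α}` (`packetLogVol_image_tprod_mul`). [claim: Mochizuki2012, status: disputed] -/
def archPortion : CapsuleDatum F A where
  X := MI A Unit
  IsAdm S := volume ((canonicalDecomposition A Unit : MI A Unit → (Idx A Unit → ℂ)) '' S) ≠ 0 ∧
    volume ((canonicalDecomposition A Unit : MI A Unit → (Idx A Unit → ℂ)) '' S) ≠ ∞
  logVol := packetLogVol (canonicalDecomposition A Unit)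
  act α f S := (fun x => tprod ℝ (archMult F A wA α f) * x) '' S
  shift α f := Real.log ((wA α) (f : F))
  isAdm_act α f S hS := by
    have hc : ∀ idx : Idx A Unit, canonicalDecomposition A Unit (tprod ℝ (archMult F A wA α f)) idx ≠ 0 :=
      fun idx => (log_norm_canonicalDecomposition_tprod (archMult F A wA α f) (archMult_ne_zero F A wA α f) idx).1
    have hprod : 0 < ∏ idx : Idx A Unit, ‖canonicalDecomposition A Unit (tprod ℝ (archMult F A wA α f)) idx‖ ^ 2 :=
      Finset.prod_pos fun idx _ => pow_pos (norm_pos_iff.mpr (hc idx)) 2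
    rw [image_mul_eq_coordMul, volume_image_coordMul]
    refine ⟨mul_ne_zero ?_ hS.1, ENNReal.mul_ne_top ENNReal.ofReal_ne_top hS.2⟩
    rwa [Ne, ENNReal.ofReal_eq_zero, not_le]
  logVol_act α f S hS := by
    haveI : Nonempty Unit := ⟨()⟩
    rw [packetLogVol_image_tprod_mul (archMult F A wA α f) (archMult_ne_zero F A wA α f) hS.1 hS.2, add_comm]
    congr 1
    simp_rw [sum_log_norm_archMult]
    rw [Finset.sum_const, Finset.card_univ, nsmul_eq_mul, ← mul_assoc,
      inv_mul_cancel₀ (by exact_mod_cast Fintype.card_ne_zero), one_mul]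

omit [NumberField F] in
/-- The shift of the archimedean portion under `f` on the label `α` is **`log|f|_{w_α}`** (`|f|_w = |σ_w(f)|`).
[claim: Mochizuki2012, status: disputed] -/
theorem archPortion_shift (α : A) (f : Fˣ) : (archPortion F A wA).shift α f = Real.log ((wA α) (f : F)) := rfl

omit [NumberField F] in
/-- The carrier of the archimedean portion is `⊗_{α,ℝ} ℂ` (definitional). [claim: Mochizuki2012, status: disputed] -/
theorem archPortion_X : (archPortion F A wA).X = MI A Unit := rfl

end Arch

end Literature.IUT.LogThetaLattice

end
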